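import Summits.QuantumFields.YangMills.Theorems.BalabanUVNodesN22AtU3OfKernels
import Literature.MathematicalPhysics.QuantumFieldTheory.Balaban1983to89.Node00.Record13CoPHChi
import Summits.QuantumFields.YangMills.Theorems.BalabanUVNodesRateCarriersOfRecord13CoPHCmap
import Literature.MathematicalPhysics.QuantumFieldTheory.Balaban1983to89.Node00.U3OfKernelsChi

/-!
# Route «BalabanUVNodes», crux K3ᴬ `SpineGivenEndpointR13SepCoPHVAx` (stmt-QuantumFields-27247) — node N22 (U3 ∕ NE9 slot): THE PIN FORMS OF `N22At` AT THE BUNDLE OF A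
# CENTRE-MAP-GENERIC («Cmap») STAGE-13 RATE READING — op 5c supply row R13 (plan g99 `D99-KAX/OP5C-SUPPLY-CENSUS-K3v8.md` §2 row 13)

Cell `pub-ymgap`, seat `pub-ymgap-dag-n16-e` (R134 (a); dag-lead g40 HANDS-4 R13 — no n22 seat live), generation 30.  `--supports stmt-QuantumFields-27247 --as helper`
(count-neutral).  NEW basename beside the UNTOUCHED parent `Thm/BalabanUVNodesN22AtU3OfKernels` (dag-n22 lineage, ns `YMDAG.N22.AtKernels`); the [Ax-3c]∕[Ax-3d] pattern:
§0 the OBJECT-GENERIC and TERM-FAMILY-GENERIC pin forms (any pinned node-U3 objects ∕ any term family — robust to a later χ-generic U3 pin); §1 the two READING-BOUND theorems of the parent's §Record — `n22At_rateCarriers_of_kernels_pin_of_ne9` (the K3 v7 skeleton's use-site `n22At_rrOfRecord_of_pinned`) and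
`n22At_rateCarriers_of_kernels_pin` — re-issued over `(𝔯 : RateReading₁₃CoPHCmap N Χ)` with binder `(hP : θ.Provisos₁₃CoPHChi F N (Χ F θ.toStage13Params))`, the bundle
`rateCarriersOfRecord₁₃CoPHCmap`, and — plan g99 σ5-a∕d «CONTENT RE-PINS» (this seat's ⚑ LOCATED, pub-ymgap INBOX l.21817) — the node-U3 objects RE-PINNED COHERENTLY to the
kernel objects of the merged term family AT THE READING's OWN β-SLOT, `objectsOfRecord₁₃Chi F N θ (Χ F θ) ℓ` (`Node00/U3OfKernelsChi`; the parent pinned the CHOICE-centred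
`objectsOfRecord₁₃`); §2 the Ax spelling over `objectsOfRecord₁₃Ax` (binder `θ.Provisos₁₃CoPHAx`) = the K3ᴬ v8 `U3PinnedKernels` currency.

HONEST FRAMING.  Kernel bookkeeping by name (two `rw`-and-cite proofs); no estimate; nothing of Bałaban asserted; the NE9 input `h9` ∕ the windowed inputs `hlim`, `hK` are
displayed HYPOTHESES at the kernel objects of record; N22 NOT discharged; K3ᴬ OPEN (skeleton unregistered at filing); counts UNMOVED (typed 28∕28 · discharged 8∕27, A 8∕28);
no `sorry`∕`instance`∕`notation`; standard axioms; one finite four-torus at fixed ε — NOT ℝ⁴ ∕ infinite volume ∕ OS ∕ mass gap ∕ Clay.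
-/

set_option autoImplicit false

noncomputable section

open Filter Topology
open scoped BigOperators Matrix.Norms.L2Operator

namespace YMDAG.N22.AtKernels

open Literature.MathematicalPhysics.QuantumFieldTheory.Balaban1983to89
open Literature.MathematicalPhysics.QuantumFieldTheory.Balaban1983to89.T4Continuum (T4Family ULoop)
open Literature.MathematicalPhysics.QuantumFieldTheory.Balaban1983to89.T4OutputRate (Window NE9)
open Literature.MathematicalPhysics.QuantumFieldTheory.Balaban1983to89.Node00 (TermFamily1 polWindow PolLimitExists mergedTermFamilyMatT TβOfRecord₁₃ chiβOfRecord₁₃ chiβOfRecord₁₃Ax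
  Stage13Params Stage13HParams ChiSlot U3Letters₁₁ U3Objects₁₁)
open Literature.MathematicalPhysics.QuantumFieldTheory.Balaban1983to89.Node00.U3OfKernels (histPrefix objects objectsOfRecord₁₃ objectsOfRecord₁₃Chi objectsOfRecord₁₃Ax EA)
open Literature.MathematicalPhysics.QuantumFieldTheory.Balaban1983to89.B12Sec2to5 (l1)
open YMDAG.UVSplit (N22At u3OfRecord₁₃ n22At_u3OfRecord₁₃_iff RateReading₁₃CoPHCmap RateReading₁₃CoPHAx rateCarriersOfRecord₁₃CoPHCmap)

variable {N : ℕ} [NeZero N] {Χ : (F : T4Family) → Stage13Params F N → ChiSlot F N}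

/-! ## §0 Object-generic and term-family-generic pin forms (serve ANY pinned node-U3 objects — the choice-centred kernel objects of record today, a χ-generic
edition of them tomorrow — by `rfl` at the pin) -/

/-- ★★ **OBJECT-GENERIC PIN FORM, centre-map-generic reading**: for a reading whose node-U3 objects at the tuple ARE some `u : U3Objects₁₁` carrying the letter signs
(`hpin`), the N22 conjunct at the bundle of run length `k` IS `NE9 (u.EA k)` on the window (`YMDAG.UVSplit.n22At_u3OfRecord₁₃_iff`) — so it holds as soon as that NE9 does.
No estimate. -/
theorem n22At_rateCarriersCmap_of_pin_of_ne9 (𝔯 : RateReading₁₃CoPHCmap N Χ) {F : T4Family} (θ : Stage13HParams F N)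
    (hP : θ.Provisos₁₃CoPHChi F N (Χ F θ.toStage13Params)) (g₀ : ℕ → ℝ) (os : List (ULoop F)) (u : U3Objects₁₁) (hs : u.Signs)
    (hpin : (𝔯.lit F θ hP g₀ os).u3 = u) (k : ℕ) (h9 : NE9 (u.EA k) (Window θ.γ) u.κ u.moduli) :
    N22At (rateCarriersOfRecord₁₃CoPHCmap 𝔯 F θ hP g₀ os k).u3 := by
  show N22At (u3OfRecord₁₃ θ.toStage13Params (𝔯.lit F θ hP g₀ os).u3 k)
  rw [hpin]
  exact (n22At_u3OfRecord₁₃_iff θ.toStage13Params u k hs).2 h9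

section TermFamily

variable {𝔄 : Type*} [NormedRing 𝔄] [NormedAlgebra ℝ 𝔄]
variable {V : Type*} [NormedAddCommGroup V] [NormedSpace ℝ V] {ι : Type*} [Fintype ι]

/-- ★★ **TERM-FAMILY-GENERIC PIN FORM, centre-map-generic reading**: for a reading whose node-U3 objects at the tuple ARE the kernel objects `objects F ℰ ρ bV ℓ` of ANY
level term family `ℰ` read in the chart `(ρ, bV)` (`hpin`; the kernel objects of record are the case `ℰ := mergedTermFamilyMatT F N (TβOfRecord₁₃ F N) χ θ.εbg`,
`ρ := θ.ρ8`, `bV := θ.bV` at the record's β-slot `χ`, any centre), the N22 conjunct holds at EVERY run length as soon as `NE9 (EA F ℰ ρ bV)` holds on the window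
(parent's `n22At_u3OfRecord₁₃_objects_of_ne9`). No estimate. -/
theorem n22At_rateCarriersCmap_of_objects_pin_of_ne9 (F : T4Family) (ℰ : TermFamily1 F 𝔄) (ρ : V →L[ℝ] 𝔄) (bV : Module.Basis ι ℝ V)
    (𝔯 : RateReading₁₃CoPHCmap N Χ) (θ : Stage13HParams F N) (hP : θ.Provisos₁₃CoPHChi F N (Χ F θ.toStage13Params)) (g₀ : ℕ → ℝ) (os : List (ULoop F))
    (ℓ : U3Letters₁₁) (hs : ℓ.Signs) (hpin : (𝔯.lit F θ hP g₀ os).u3 = objects F ℰ ρ bV ℓ)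
    (h9 : NE9 (EA F ℰ ρ bV) (Window θ.γ) ℓ.κ ℓ.moduli) (k : ℕ) :
    N22At (rateCarriersOfRecord₁₃CoPHCmap 𝔯 F θ hP g₀ os k).u3 := by
  show N22At (u3OfRecord₁₃ θ.toStage13Params (𝔯.lit F θ hP g₀ os).u3 k)
  rw [hpin]
  exact n22At_u3OfRecord₁₃_objects_of_ne9 F ℰ ρ bV θ.toStage13Params ℓ hs k h9

/-- ★ **TERM-FAMILY-GENERIC PIN FORM FROM THE WINDOWED BOUNDS AND THE EXISTENCE OF THE (1.21) LIMITS** (parent's `n22At_u3OfRecord₁₃_objects_of_windowed`; both inputs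
displayed). No estimate. -/
theorem n22At_rateCarriersCmap_of_objects_pin_of_windowed (F : T4Family) (ℰ : TermFamily1 F 𝔄) (ρ : V →L[ℝ] 𝔄) (bV : Module.Basis ι ℝ V)
    (𝔯 : RateReading₁₃CoPHCmap N Χ) (θ : Stage13HParams F N) (hP : θ.Provisos₁₃CoPHChi F N (Χ F θ.toStage13Params)) (g₀ : ℕ → ℝ) (os : List (ULoop F))
    (ℓ : U3Letters₁₁) (hs : ℓ.Signs) (hpin : (𝔯.lit F θ hP g₀ os).u3 = objects F ℰ ρ bV ℓ)
    (hlim : ∀ g ∈ Window θ.γ, ∀ j : ℕ, PolLimitExists F (j + 1) (fun K => ℰ j (histPrefix g j) K) ρ bV)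
    (hK : ∀ g ∈ Window θ.γ, ∀ g' ∈ Window θ.γ, ∀ (j : ℕ) (μ ν : Fin 4) (z : Fin 4 → ℤ), ∀ᶠ K in atTop,
      |polWindow F K (j + 1) (ℰ j (histPrefix g j) K) ρ bV μ ν z - polWindow F K (j + 1) (ℰ j (histPrefix g' j) K) ρ bV μ ν z| ≤
        Real.exp (-(ℓ.κ * l1 z)) * ∑ i ∈ Finset.range (j + 1), ℓ.moduli (j + 1) i * |g i - g' i|)
    (k : ℕ) : N22At (rateCarriersOfRecord₁₃CoPHCmap 𝔯 F θ hP g₀ os k).u3 := by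
  show N22At (u3OfRecord₁₃ θ.toStage13Params (𝔯.lit F θ hP g₀ os).u3 k)
  rw [hpin]
  exact n22At_u3OfRecord₁₃_objects_of_windowed F ℰ ρ bV θ.toStage13Params ℓ hs k hlim hK

end TermFamily

/-! ## §1 The pin forms at a centre-map-generic reading, node-U3 objects RE-PINNED COHERENTLY (plan g99 σ5-a∕d): the kernel objects of the merged term family AT
THE READING's OWN β-SLOT `Χ F θ` (`objectsOfRecord₁₃Chi`, this seat's `Node00/U3OfKernelsChi`) -/

/-- ★★ **THE PIN FORM AT A CENTRE-MAP-GENERIC READING, FROM NE9 OF THE KERNEL FUNCTIONAL AT THE READING's β-SLOT**: `n22At_rateCarriers_of_kernels_pin_of_ne9` with the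
node-U3 objects pinned to `objectsOfRecord₁₃Chi F N θ (Χ F θ) ℓ` (σ5: the SAME cut-off the reading's provisos and datum read) — the N22 conjunct holds at the bundle of
EVERY run length as soon as `NE9` of that kernel functional holds on the window.  The K3ᴬ v8 use-site at `Χ := chiβOfRecord₁₃Ax` (§2). -/
theorem n22At_rateCarriersCmap_of_kernels_pin_of_ne9 (𝔯 : RateReading₁₃CoPHCmap N Χ) {F : T4Family} (θ : Stage13HParams F N)
    (hP : θ.Provisos₁₃CoPHChi F N (Χ F θ.toStage13Params)) (g₀ : ℕ → ℝ) (os : List (ULoop F)) (ℓ : U3Letters₁₁) (hs : ℓ.Signs)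
    (hpin : (𝔯.lit F θ hP g₀ os).u3 = objectsOfRecord₁₃Chi F N θ.toStage13Params (Χ F θ.toStage13Params) ℓ)
    (h9 : NE9 ((objectsOfRecord₁₃Chi F N θ.toStage13Params (Χ F θ.toStage13Params) ℓ).EA 0) (Window θ.γ) ℓ.κ ℓ.moduli) (k : ℕ) :
    N22At (rateCarriersOfRecord₁₃CoPHCmap 𝔯 F θ hP g₀ os k).u3 := by
  letI := θ.instVβ₁; letI := θ.instVβ₂; letI := θ.instιβ
  exact n22At_rateCarriersCmap_of_objects_pin_of_ne9 F _ θ.ρ8 θ.bV 𝔯 θ hP g₀ os ℓ hs hpin h9 k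

/-- ★★ **THE PIN FORM AT A CENTRE-MAP-GENERIC READING, FROM THE WINDOWED BOUNDS AND THE EXISTENCE OF THE (1.21) LIMITS AT THE READING's β-SLOT**:
`n22At_rateCarriers_of_kernels_pin` with the objects pinned to `objectsOfRecord₁₃Chi F N θ (Χ F θ) ℓ` and the two displayed inputs read at the merged term family AT `Χ F θ`.
LOCATED (hypothesis form); N22 NOT discharged. -/
theorem n22At_rateCarriersCmap_of_kernels_pin (𝔯 : RateReading₁₃CoPHCmap N Χ) {F : T4Family} (θ : Stage13HParams F N)
    (hP : θ.Provisos₁₃CoPHChi F N (Χ F θ.toStage13Params)) (g₀ : ℕ → ℝ) (os : List (ULoop F)) (ℓ : U3Letters₁₁) (hs : ℓ.Signs)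
    (hpin : (𝔯.lit F θ hP g₀ os).u3 = objectsOfRecord₁₃Chi F N θ.toStage13Params (Χ F θ.toStage13Params) ℓ)
    (hlim : letI := θ.instVβ₁; letI := θ.instVβ₂; letI := θ.instιβ
      ∀ g ∈ Window θ.γ, ∀ j : ℕ,
        PolLimitExists F (j + 1)
          (fun K => mergedTermFamilyMatT F N (TβOfRecord₁₃ F N) (Χ F θ.toStage13Params) θ.εbg j (histPrefix g j) K) θ.ρ8 θ.bV)
    (hK : letI := θ.instVβ₁; letI := θ.instVβ₂; letI := θ.instιβ
      ∀ g ∈ Window θ.γ, ∀ g' ∈ Window θ.γ, ∀ (j : ℕ) (μ ν : Fin 4) (z : Fin 4 → ℤ), ∀ᶠ K in atTop,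
        |polWindow F K (j + 1)
              (mergedTermFamilyMatT F N (TβOfRecord₁₃ F N) (Χ F θ.toStage13Params) θ.εbg j (histPrefix g j) K) θ.ρ8 θ.bV μ ν z -
            polWindow F K (j + 1)
              (mergedTermFamilyMatT F N (TβOfRecord₁₃ F N) (Χ F θ.toStage13Params) θ.εbg j (histPrefix g' j) K) θ.ρ8 θ.bV μ ν z| ≤
          Real.exp (-(ℓ.κ * l1 z)) * ∑ i ∈ Finset.range (j + 1), ℓ.moduli (j + 1) i * |g i - g' i|)
    (k : ℕ) : N22At (rateCarriersOfRecord₁₃CoPHCmap 𝔯 F θ hP g₀ os k).u3 := by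
  letI := θ.instVβ₁; letI := θ.instVβ₂; letI := θ.instιβ
  exact n22At_rateCarriersCmap_of_objects_pin_of_windowed F _ θ.ρ8 θ.bV 𝔯 θ hP g₀ os ℓ hs hpin hlim hK k

/-! ## §2 The Ax instance, spelled: node-U3 objects pinned to `objectsOfRecord₁₃Ax` (the K3ᴬ v8 `U3PinnedKernels` after σ5-a) -/

/-- ★ **THE PIN FORM AT THE RE-CENTRED READING, FROM NE9** — §1 at `Χ := fun F => chiβOfRecord₁₃Ax F N` (binder `hP : θ.Provisos₁₃CoPHAx F N`, objects
`objectsOfRecord₁₃Ax`, whose functionals represent `betaOfRecord₁₃Ax` — `Node00/U3OfKernelsChi`). -/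
theorem n22At_rateCarriersAx_of_kernels_pin_of_ne9 (𝔯 : RateReading₁₃CoPHAx N) {F : T4Family} (θ : Stage13HParams F N) (hP : θ.Provisos₁₃CoPHAx F N)
    (g₀ : ℕ → ℝ) (os : List (ULoop F)) (ℓ : U3Letters₁₁) (hs : ℓ.Signs)
    (hpin : (𝔯.lit F θ hP g₀ os).u3 = objectsOfRecord₁₃Ax F N θ.toStage13Params ℓ)
    (h9 : NE9 ((objectsOfRecord₁₃Ax F N θ.toStage13Params ℓ).EA 0) (Window θ.γ) ℓ.κ ℓ.moduli) (k : ℕ) :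
    N22At (rateCarriersOfRecord₁₃CoPHCmap 𝔯 F θ hP g₀ os k).u3 :=
  n22At_rateCarriersCmap_of_kernels_pin_of_ne9 𝔯 θ hP g₀ os ℓ hs hpin h9 k

end YMDAG.N22.AtKernels

end
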